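import Mathlib

/-!
# Holomorphic cube-parametric integrals: constant on the real diameter ⇒ constant on the disc

Stub `stub_stripIdentity` (K-B, the analytic heart of section K = the Götzky–Koecher principle at the
cusp `∞`, Freitag, *Hilbert Modular Forms*, Ch. I Prop. 4.9) for the crux
`HilbertIntegralOverconvergentIsCongruence` (line Sketch-ideate-r1-k1).  It is the one place where
holomorphy enters the proof that the Fourier coefficient `a_ν(y) = ∫_{[0,1]^n} f(x+iy) e^{-2πi S(ν(x+iy))} dx`
does not depend on the height `y`: for a holomorphic `H` on an open `Ω ⊆ ℂ^τ`, a continuous family of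
base points `p(x)`, `x ∈ [0,1]^ι`, and a direction `u` with `p(x) + s u ∈ Ω` for `‖s‖ ≤ δ`, the function
`Ψ(s) = ∫_{[0,1]^ι} H(p(x) + s u) dx` is holomorphic on the disc `‖s‖ < δ`; if it is constant on the real
diameter it is constant on the whole disc.

Proof.
* `Ψ` is complex differentiable at every `s₀` of the disc: differentiate under the integral sign
  (`hasDerivAt_integral_of_dominated_loc_of_deriv_le`) with `F' s x = H'(p x + s u) u`, the derivative of
  the one-variable holomorphic function `s ↦ H(p x + s u)`; the domination is UNIFORM: `‖H‖ ≤ C` on the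
  compact set `{p x + s u : x ∈ [0,1]^ι, ‖s‖ ≤ δ} ⊆ Ω`, and the Cauchy estimate
  (`Complex.norm_deriv_le_of_forall_mem_sphere_norm_le`) on circles of radius `ρ = (δ - ‖s₀‖)/4` bounds
  the derivative by `C/ρ` for all `s` near `s₀` and all `x` in the cube.
* Identity theorem (`AnalyticOnNhd.eqOn_of_preconnected_of_frequently_eq`) on the (convex, hence
  preconnected) disc: `Ψ` agrees with the constant `Ψ(0)` frequently near `0` (at all small non-zero
  reals), hence everywhere.
-/

set_option linter.dupNamespace false

noncomputable section

namespace Summit.Langlands.Langlands.Theorems.HilbertIntegralOverconvergentIsCongruence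

open MeasureTheory Complex Metric Filter Topology Set

/-- The one-variable restriction `s ↦ H (p + s • u)` of a function differentiable on an open `Ω` has
derivative `H'(p + s • u) u` at every `s` with `p + s • u ∈ Ω` (chain rule). -/
theorem kB_hasDerivAt_line {τ : Type} [Fintype τ] {H : (τ → ℂ) → ℂ} {Ω : Set (τ → ℂ)}
    (hΩ : IsOpen Ω) (hH : DifferentiableOn ℂ H Ω) (p u : τ → ℂ) {s : ℂ} (hs : p + s • u ∈ Ω) :
    HasDerivAt (fun s : ℂ ↦ H (p + s • u)) (fderiv ℂ H (p + s • u) u) s := by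
  have hHd : HasFDerivAt H (fderiv ℂ H (p + s • u)) (p + s • u) :=
    (hH.differentiableAt (hΩ.mem_nhds hs)).hasFDerivAt
  have hinner : HasDerivAt (fun s : ℂ ↦ p + s • u) u s := by
    simpa using ((hasDerivAt_id s).smul_const u).const_add p
  exact hHd.comp_hasDerivAt s hinner

/-- The one-variable restriction is differentiable at every `s` with `p + s • u ∈ Ω`. -/
theorem kB_differentiableAt_line {τ : Type} [Fintype τ] {H : (τ → ℂ) → ℂ} {Ω : Set (τ → ℂ)}
    (hΩ : IsOpen Ω) (hH : DifferentiableOn ℂ H Ω) (p u : τ → ℂ) {s : ℂ} (hs : p + s • u ∈ Ω) :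
    DifferentiableAt ℂ (fun s : ℂ ↦ H (p + s • u)) s :=
  (kB_hasDerivAt_line hΩ hH p u hs).differentiableAt

/-- A uniform bound for `‖H‖` on the compact set of arguments `{p x + s • u : x ∈ [0,1]^ι, ‖s‖ ≤ δ} ⊆ Ω`
(continuity of `H` on `Ω`). -/
theorem kB_exists_norm_le {ι τ : Type} [Fintype ι] [Fintype τ] {H : (τ → ℂ) → ℂ} {Ω : Set (τ → ℂ)}
    (hH : DifferentiableOn ℂ H Ω) {p : (ι → ℝ) → (τ → ℂ)} (hp : Continuous p) (u : τ → ℂ) (δ : ℝ)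
    (hmem : ∀ x ∈ Set.Icc (0 : ι → ℝ) 1, ∀ s : ℂ, ‖s‖ ≤ δ → p x + s • u ∈ Ω) :
    ∃ C : ℝ, ∀ x ∈ Set.Icc (0 : ι → ℝ) 1, ∀ s : ℂ, ‖s‖ ≤ δ → ‖H (p x + s • u)‖ ≤ C := by
  set K : Set (τ → ℂ) := (fun q : (ι → ℝ) × ℂ ↦ p q.1 + q.2 • u) '' (Set.Icc 0 1 ×ˢ closedBall 0 δ)
    with hK
  have hKc : IsCompact K :=
    (isCompact_Icc.prod (isCompact_closedBall 0 δ)).image (by fun_prop)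
  have hKΩ : K ⊆ Ω := by
    rintro _ ⟨⟨x, s⟩, ⟨hx, hs⟩, rfl⟩
    exact hmem x hx s (mem_closedBall_zero_iff.1 hs)
  obtain ⟨C, hC⟩ := hKc.exists_bound_of_continuousOn (hH.continuousOn.mono hKΩ)
  exact ⟨C, fun x hx s hs ↦ hC _ ⟨⟨x, s⟩, ⟨hx, mem_closedBall_zero_iff.2 hs⟩, rfl⟩⟩

/-- **Differentiability of the cube-parametric integral** `Ψ(s) = ∫_{[0,1]^ι} H(p x + s • u) dx` at every
point `s₀` of the disc `‖s₀‖ < δ`, by differentiation under the integral sign with the uniform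
Cauchy-estimate domination. -/
theorem kB_hasDerivAt_integral {ι τ : Type} [Fintype ι] [Fintype τ] (H : (τ → ℂ) → ℂ) (Ω : Set (τ → ℂ))
    (hΩ : IsOpen Ω) (hH : DifferentiableOn ℂ H Ω) (p : (ι → ℝ) → (τ → ℂ)) (hp : Continuous p)
    (u : τ → ℂ) (δ : ℝ)
    (hmem : ∀ x ∈ Set.Icc (0 : ι → ℝ) 1, ∀ s : ℂ, ‖s‖ ≤ δ → p x + s • u ∈ Ω)
    {s₀ : ℂ} (hs₀ : ‖s₀‖ < δ) :
    DifferentiableAt ℂ (fun s : ℂ ↦ ∫ x in Set.Icc (0 : ι → ℝ) 1, H (p x + s • u)) s₀ := by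
  obtain ⟨C, hC⟩ := kB_exists_norm_le hH hp u δ hmem
  -- radius of the Cauchy circles and of the neighbourhood of `s₀`
  set ρ : ℝ := (δ - ‖s₀‖) / 4 with hρ
  have hρpos : 0 < ρ := by rw [hρ]; linarith
  -- every `s` within `3ρ` of `s₀` has `‖s‖ ≤ δ`
  have hnorm : ∀ s : ℂ, dist s s₀ ≤ 3 * ρ → ‖s‖ ≤ δ := fun s hs ↦ by
    have h1 : ‖s‖ ≤ ‖s₀‖ + dist s s₀ := by
      rw [dist_eq_norm]; exact norm_le_norm_add_norm_sub' s s₀ |>.trans (by rw [norm_sub_rev]) |> fun h ↦ by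
        calc ‖s‖ = ‖s₀ + (s - s₀)‖ := by rw [add_sub_cancel]
          _ ≤ ‖s₀‖ + ‖s - s₀‖ := norm_add_le _ _
    have : ‖s₀‖ + 3 * ρ ≤ δ := by rw [hρ]; linarith
    linarith
  -- the derivative family and its uniform bound
  set F' : ℂ → (ι → ℝ) → ℂ := fun s x ↦ fderiv ℂ H (p x + s • u) u with hF'
  have hderiv_bound : ∀ x ∈ Set.Icc (0 : ι → ℝ) 1, ∀ s ∈ ball s₀ ρ, ‖F' s x‖ ≤ C / ρ := by
    intro x hx s hs
    -- Cauchy estimate for `g := fun s ↦ H (p x + s • u)` on the circle of radius `ρ` about `s`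
    have hcl : closedBall s ρ ⊆ {s' : ℂ | ‖s'‖ ≤ δ} := fun s' hs' ↦ hnorm s' <| by
      have h1 : dist s' s ≤ ρ := mem_closedBall.1 hs'
      have h2 : dist s s₀ < ρ := mem_ball.1 hs
      linarith [dist_triangle s' s s₀]
    have hdiff : DifferentiableOn ℂ (fun s' : ℂ ↦ H (p x + s' • u)) {s' : ℂ | ‖s'‖ ≤ δ} :=
      fun s' hs' ↦ (kB_differentiableAt_line hΩ hH (p x) u (hmem x hx s' hs')).differentiableWithinAt
    have hdc : DiffContOnCl ℂ (fun s' : ℂ ↦ H (p x + s' • u)) (ball s ρ) := hdiff.diffContOnCl_ball hcl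
    have hsph : ∀ s' ∈ sphere s ρ, ‖H (p x + s' • u)‖ ≤ C := fun s' hs' ↦
      hC x hx s' (hcl (sphere_subset_closedBall hs'))
    have key := Complex.norm_deriv_le_of_forall_mem_sphere_norm_le hρpos hdc hsph
    have hsΩ : p x + s • u ∈ Ω := hmem x hx s (hcl (mem_closedBall_self hρpos.le))
    rwa [(kB_hasDerivAt_line hΩ hH (p x) u hsΩ).deriv] at key
  -- continuity of the integrands on the cube
  have hcont : ∀ s : ℂ, ‖s‖ ≤ δ → ContinuousOn (fun x : ι → ℝ ↦ H (p x + s • u)) (Set.Icc 0 1) :=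
    fun s hs ↦ hH.continuousOn.comp (by fun_prop) fun x hx ↦ hmem x hx s hs
  have hmeas : ∀ s : ℂ, ‖s‖ ≤ δ →
      AEStronglyMeasurable (fun x : ι → ℝ ↦ H (p x + s • u)) (volume.restrict (Set.Icc 0 1)) :=
    fun s hs ↦ (hcont s hs).aestronglyMeasurable measurableSet_Icc
  have hball : ball s₀ ρ ∈ 𝓝 s₀ := ball_mem_nhds s₀ hρpos
  have hball_norm : ∀ s ∈ ball s₀ ρ, ‖s‖ ≤ δ := fun s hs ↦ hnorm s (by
    have := mem_ball.1 hs; linarith)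
  have h := hasDerivAt_integral_of_dominated_loc_of_deriv_le (μ := volume.restrict (Set.Icc (0 : ι → ℝ) 1))
    (F := fun s x ↦ H (p x + s • u)) (F' := F') (x₀ := s₀) (bound := fun _ ↦ C / ρ) hball
    (Filter.eventually_of_mem hball fun s hs ↦ hmeas s (hball_norm s hs))
    ((hcont s₀ hs₀.le).integrableOn_compact isCompact_Icc)
    (((measurable_fderiv_apply_const ℂ H u).comp
      (by fun_prop : Measurable fun x : ι → ℝ ↦ p x + s₀ • u)).aestronglyMeasurable)
    ((ae_restrict_iff' measurableSet_Icc).2 (Filter.Eventually.of_forall fun x hx s hs ↦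
      hderiv_bound x hx s hs))
    ((integrableOn_const_iff).2 (Or.inr (measure_Icc_lt_top)))
    ((ae_restrict_iff' measurableSet_Icc).2 (Filter.Eventually.of_forall fun x hx s hs ↦
      kB_hasDerivAt_line hΩ hH (p x) u (hmem x hx s (hball_norm s hs))))
  exact h.2.differentiableAt

/-- **stub K-B — `stub_stripIdentity`.** A cube-parametric integral `Ψ(s) = ∫_{[0,1]^ι} H(p(x) + s·u) dx`
of a holomorphic `H` (on an open `Ω` containing all `p(x) + s·u`, `‖s‖ ≤ δ`, `p` continuous) is
holomorphic in `s` on the disc `‖s‖ < δ` (`kB_hasDerivAt_integral`); if it is constant on the real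
diameter it is constant on the disc (identity theorem on the preconnected disc, the reals accumulating
at `0`). [folklore] -/
theorem stub_stripIdentity {ι τ : Type} [Fintype ι] [Fintype τ] (H : (τ → ℂ) → ℂ) (Ω : Set (τ → ℂ))
    (hΩ : IsOpen Ω) (hH : DifferentiableOn ℂ H Ω) (p : (ι → ℝ) → (τ → ℂ)) (hp : Continuous p)
    (u : τ → ℂ) (δ : ℝ) (hδ : 0 < δ)
    (hmem : ∀ x ∈ Set.Icc (0 : ι → ℝ) 1, ∀ s : ℂ, ‖s‖ ≤ δ → p x + s • u ∈ Ω)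
    (hreal : ∀ s : ℝ, |s| < δ →
      ∫ x in Set.Icc (0 : ι → ℝ) 1, H (p x + (s : ℂ) • u) = ∫ x in Set.Icc (0 : ι → ℝ) 1, H (p x)) :
    ∀ s : ℂ, ‖s‖ < δ →
      ∫ x in Set.Icc (0 : ι → ℝ) 1, H (p x + s • u) = ∫ x in Set.Icc (0 : ι → ℝ) 1, H (p x) := by
  set Ψ : ℂ → ℂ := fun s ↦ ∫ x in Set.Icc (0 : ι → ℝ) 1, H (p x + s • u) with hΨ
  -- `Ψ` is analytic on the disc
  have hdiff : DifferentiableOn ℂ Ψ (ball 0 δ) := fun s hs ↦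
    (kB_hasDerivAt_integral H Ω hΩ hH p hp u δ hmem (mem_ball_zero_iff.1 hs)).differentiableWithinAt
  have han : AnalyticOnNhd ℂ Ψ (ball 0 δ) := hdiff.analyticOnNhd isOpen_ball
  -- `Ψ = Ψ 0` frequently near `0` (at the small non-zero reals)
  have hΨ0 : Ψ 0 = ∫ x in Set.Icc (0 : ι → ℝ) 1, H (p x) := by simp [hΨ]
  have hev : ∀ᶠ t : ℝ in 𝓝[≠] 0, Ψ (t : ℂ) = Ψ 0 := by
    have h1 : ∀ᶠ t : ℝ in 𝓝 0, |t| < δ := by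
      simpa [abs_sub_comm] using Metric.ball_mem_nhds (0 : ℝ) hδ |> fun h ↦
        (Filter.eventually_of_mem h fun t ht ↦ by simpa [Real.dist_eq] using ht)
    filter_upwards [nhdsWithin_le_nhds h1] with t ht
    rw [hΨ0]
    exact hreal t ht
  have htend : Tendsto (fun t : ℝ ↦ (t : ℂ)) (𝓝[≠] 0) (𝓝[≠] 0) := by
    have hc : ContinuousWithinAt (fun t : ℝ ↦ (t : ℂ)) {0}ᶜ 0 :=
      Complex.continuous_ofReal.continuousWithinAt
    have hmaps : MapsTo (fun t : ℝ ↦ (t : ℂ)) {0}ᶜ {0}ᶜ := fun t ht ↦ by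
      simpa using ht
    simpa using hc.tendsto_nhdsWithin hmaps
  have hfreq : ∃ᶠ z in 𝓝[≠] (0 : ℂ), Ψ z = Ψ 0 := by
    have h2 : ∃ᶠ t : ℝ in 𝓝[≠] 0, Ψ (t : ℂ) = Ψ 0 := hev.frequently
    exact (Filter.frequently_map.2 h2 |>.filter_mono htend) |> fun h ↦ by simpa using h
  have heq : EqOn Ψ (fun _ ↦ Ψ 0) (ball 0 δ) :=
    han.eqOn_of_preconnected_of_frequently_eq analyticOnNhd_const (convex_ball 0 δ).isPreconnected
      (mem_ball_self hδ) hfreq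
  intro s hs
  have := heq (mem_ball_zero_iff.2 hs)
  simpa only [hΨ, zero_smul, add_zero] using this

end Summit.Langlands.Langlands.Theorems.HilbertIntegralOverconvergentIsCongruence
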